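import Literature.NumberTheory.Automorphic.BorelCompactPartGL
import Literature.NumberTheory.Automorphic.SiegelConeDyadic
import Literature.NumberTheory.Automorphic.GLnIwasawaIntegration
import HarnessLib

/-!
# Iwasawa coordinates of translated Siegel pieces

A brick of the proof of the Borel–Harish-Chandra finiteness theorem for `GL_n`
(`AdelicGroupData.exists_isAutomorphicMeasure_gl`; Godement, Sém. Bourbaki 257, §8, remark after
Thm. 7). The Haar measure of `GL_n(𝔸_K)` is a product measure in the coordinates `g = m u k`
(`m` diagonal, `u` unipotent, `k ∈ K`: `HaarHK.eq_smul_map_prod` and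
`IsTopSemidirect.isHaarMeasure_map` of the tree). This file controls the coordinates of the pieces
`(d Ω d⁻¹) · P₀ · K` of a Siegel set translated back by a cone element `d`:

* `unipotentRadicalPEquiv : U_id ≃ₜ* N_n(𝔸_K)` — the unipotent radical of the Borel subgroup
  (a subgroup of the subgroup `B`) is the upper unitriangular group; `posRealTorus a` — `diag(z(a))`
  as an element of the diagonal torus `M_id ≤ B`;
* `exists_isCompact_coordinates_subset` — for compact `Ω ⊆ B(𝔸_K)` and compact diagonal `P₀` there
  are compact `T_E ⊆ M_id`, `N_E ⊆ N_n(𝔸_K)` such that for **every** positive real diagonal `d`: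
  `m u ∈ (d Ω d⁻¹) P₀ K ⇒ m ∈ T_E ∧ u ∈ d N_E d⁻¹` — because the torus is commutative and `d`
  fixes the unipotent parts of `B ∩ K` (`BorelCompactPartGL`).

Everything is proved.
-/

noncomputable section

open MeasureTheory NumberField IsDedekindDomain Matrix Set
open scoped MatrixGroups NNReal Pointwise

namespace Literature.NumberTheory.Automorphic

section Coordinates

variable (n : ℕ) (K : Type) [Field K] [NumberField K]

local notation "𝔸" => AdeleRing (𝓞 K) K
local notation "Bor" => standardParabolicGL (AdeleRing (𝓞 K) K) (id : Fin n → Fin n)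
local notation "Tor" => leviP (AdeleRing (𝓞 K) K) (id : Fin n → Fin n)
local notation "Uni" => unipotentRadicalP (AdeleRing (𝓞 K) K) (id : Fin n → Fin n)

variable {n K} in
/-- An upper unitriangular matrix, viewed in `B`, lies in the unipotent radical `U_id`
(`unipotentRadicalGL_subgroupOf`). [folklore] -/
theorem mem_unipotentRadicalP_id_of_mem {v : GL (Fin n) 𝔸} (hv : v ∈ adelicUnipotent n K) :
    (⟨v, upperUnitriangular_le_standardParabolicGL hv⟩ : ↥(Bor)) ∈ (Uni) := by
  rw [← unipotentRadicalGL_subgroupOf, Subgroup.mem_subgroupOf]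
  exact hv

/-- **The unipotent radical of the Borel subgroup is `N_n(𝔸_K)`**: the tautological isomorphism of
topological groups between `U_id ≤ B(𝔸_K)` (a subgroup of the subgroup `B`, the kernel of the Levi
projection) and the upper unitriangular group `adelicUnipotent n K ≤ GL_n(𝔸_K)`. [folklore] -/
def unipotentRadicalPEquiv : ↥(Uni) ≃ₜ* ↥(adelicUnipotent n K) where
  toFun u := ⟨((u : Bor) : GL (Fin n) 𝔸), (u : Bor), u.2, rfl⟩
  invFun v := ⟨⟨(v : GL (Fin n) 𝔸), upperUnitriangular_le_standardParabolicGL v.2⟩,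
    mem_unipotentRadicalP_id_of_mem v.2⟩
  left_inv _ := rfl
  right_inv _ := rfl
  map_mul' _ _ := rfl
  continuous_toFun := (continuous_subtype_val.comp continuous_subtype_val).subtype_mk _
  continuous_invFun := (continuous_subtype_val.subtype_mk _).subtype_mk _

/-- `unipotentRadicalPEquiv u` has the same underlying matrix as `u`. [folklore] -/
@[simp]
theorem coe_unipotentRadicalPEquiv (u : ↥(Uni)) :
    ((unipotentRadicalPEquiv n K u : ↥(adelicUnipotent n K)) : GL (Fin n) 𝔸) = (u : Bor) := rfl

/-- The positive real diagonal matrix `diag(z(a))` as an element of the diagonal torus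
`M_id ≤ B(𝔸_K)`. [folklore] -/
def posRealTorus (a : Fin n → ℝ≥0ˣ) : ↥(Tor) :=
  ⟨⟨posRealDiagonal n K a, posRealDiagonal_mem_standardParabolicGL a⟩, glDiagonal_mem_leviP_id _⟩

/-- The underlying matrix of `posRealTorus a` is `posRealDiagonal a`. [folklore] -/
@[simp]
theorem coe_posRealTorus (a : Fin n → ℝ≥0ˣ) :
    (((posRealTorus n K a : ↥(Tor)) : Bor) : GL (Fin n) 𝔸) = posRealDiagonal n K a := rfl

/-- Conjugating an element of `U_id` by `diag(z(a))` inside `B` is, on `N_n(𝔸_K)`, the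
conjugation `unipotentDiagConj (z ∘ a)`. [folklore] -/
theorem unipotentRadicalPEquiv_conj (a : Fin n → ℝ≥0ˣ) (u : ↥(Uni)) :
    unipotentRadicalPEquiv n K
        ⟨(posRealTorus n K a : Bor) * u * ((posRealTorus n K a : Bor))⁻¹,
          (inferInstance : (Uni).Normal).conj_mem _ u.2 _⟩ =
      unipotentDiagConj (fun i => posRealIdele K (a i)) (unipotentRadicalPEquiv n K u) :=
  rfl

variable {n K}

/-- **Iwasawa coordinates of the translated Siegel pieces.** Let `Ω ⊆ B(𝔸_K)` and
`P₀ ⊆ {diag(z(q))}` be compact. There are compact sets `T_E ⊆ M_id` and `N_E ⊆ N_n(𝔸_K)` such that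
for **every** positive real diagonal `d = diag(z(a))`: if `m u ∈ (d Ω d⁻¹) · P₀ · K` with `m`
diagonal and `u` unipotent, then `m ∈ T_E` and `u ∈ d N_E d⁻¹`.

*Proof.* Write `ω = a_ω u_ω`, `κ = a_κ u_κ` (Levi–unipotent coordinates) and `p ∈ P₀`; then
`d ω d⁻¹ p κ = (a_ω p a_κ) · d ((p a_κ)⁻¹ u_ω (p a_κ) u_κ) d⁻¹`, because the torus is commutative and
`d u_κ d⁻¹ = u_κ` — the unipotent parts of elements of `B ∩ K` have trivial archimedean component
(`fst_apply_unipotentPart_eq_zero`, `unipotentDiagConj_posRealIdele_eq_self`). Hence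
`T_E = T_Ω P₀ T_K` and `N_E = ((P₀ T_K)⁻¹ U_Ω (P₀ T_K)) · U_K` serve, where `T_Ω, U_Ω, T_K, U_K`
are the (compact) coordinate projections of `Ω` and `B ∩ K`. [folklore] -/
theorem exists_isCompact_coordinates_subset
    {Ω : Set (GL (Fin n) 𝔸)} (hΩc : IsCompact Ω) (hΩP : Ω ⊆ (Bor : Set (GL (Fin n) 𝔸)))
    {P₀ : Set (GL (Fin n) 𝔸)} (hP₀c : IsCompact P₀) (hP₀ : P₀ ⊆ Set.range (posRealDiagonal n K)) :
    ∃ (T_E : Set ↥(Tor)) (N_E : Set ↥(adelicUnipotent n K)), IsCompact T_E ∧ IsCompact N_E ∧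
      ∀ (a : Fin n → ℝ≥0ˣ) (m : ↥(Tor)) (u : ↥(Uni)),
        ((m : Bor) : GL (Fin n) 𝔸) * ((u : Bor) : GL (Fin n) 𝔸) ∈
          (fun ω => posRealDiagonal n K a * ω * (posRealDiagonal n K a)⁻¹) '' Ω * P₀ *
            (standardMaximalCompactGL n K : Set (GL (Fin n) 𝔸)) →
        m ∈ T_E ∧ unipotentRadicalPEquiv n K u ∈
          unipotentDiagConj (fun i => posRealIdele K (a i)) '' N_E := by
  haveI : T2Space (GL (Fin n) 𝔸) := t2Space_gl n K
  haveI : T2Space 𝔸 := t2Space_adeleRing K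
  have hsd := isTopSemidirect_parabolicAdelic n K (id : Fin n → Fin n)
  set e := leviUnipotentHomeomorph (AdeleRing (𝓞 K) K) (id : Fin n → Fin n) with he
  have hBc : IsClosed ((Bor : Subgroup (GL (Fin n) 𝔸)) : Set (GL (Fin n) 𝔸)) :=
    standardParabolicGL_isClosed (id : Fin n → Fin n)
  have hemb : Topology.IsClosedEmbedding (Subtype.val : ↥(Bor) → GL (Fin n) 𝔸) :=
    hBc.isClosedEmbedding_subtypeVal
  -- compact lifts of `Ω`, `P₀`, `B ∩ K` to `B`
  set Ω' : Set ↥(Bor) := Subtype.val ⁻¹' Ω with hΩ'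
  have hΩ'c : IsCompact Ω' := hemb.isCompact_preimage hΩc
  set P₀' : Set ↥(Bor) := Subtype.val ⁻¹' P₀ with hP₀'
  have hP₀'c : IsCompact P₀' := hemb.isCompact_preimage hP₀c
  set K' : Set ↥(Bor) := Subtype.val ⁻¹' (standardMaximalCompactGL n K : Set (GL (Fin n) 𝔸))
    with hK'
  have hK'c : IsCompact K' := hemb.isCompact_preimage (isCompact_standardMaximalCompactGL n K)
  -- coordinate projections
  set TΩ : Set ↥(Tor) := Prod.fst '' (e.symm '' Ω') with hTΩ
  set UΩ : Set ↥(Uni) := Prod.snd '' (e.symm '' Ω') with hUΩ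
  set TK : Set ↥(Tor) := Prod.fst '' (e.symm '' K') with hTK
  set UK : Set ↥(Uni) := Prod.snd '' (e.symm '' K') with hUK
  set T₀ : Set ↥(Tor) := Subtype.val ⁻¹' P₀' with hT₀
  have hTΩc : IsCompact TΩ := ((hΩ'c.image e.symm.continuous).image continuous_fst)
  have hUΩc : IsCompact UΩ := ((hΩ'c.image e.symm.continuous).image continuous_snd)
  have hTKc : IsCompact TK := ((hK'c.image e.symm.continuous).image continuous_fst)
  have hUKc : IsCompact UK := ((hK'c.image e.symm.continuous).image continuous_snd)
  have hT₀c : IsCompact T₀ :=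
    (hsd.isClosed_left.isClosedEmbedding_subtypeVal).isCompact_preimage hP₀'c
  -- the conjugation action of the torus on the unipotent radical
  set cj : ↥(Tor) × ↥(Uni) → ↥(Uni) := fun q =>
    ⟨((q.1 : Bor))⁻¹ * (q.2 : Bor) * (q.1 : Bor), hsd.conj_mem q.1 q.2⟩ with hcj
  have hcj_cont : Continuous cj :=
    (((continuous_subtype_val.comp continuous_fst).inv.mul
      (continuous_subtype_val.comp continuous_snd)).mul
      (continuous_subtype_val.comp continuous_fst)).subtype_mk _
  set V : Set ↥(Uni) := cj '' ((T₀ * TK) ×ˢ UΩ) * UK with hV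
  have hVc : IsCompact V := (((hT₀c.mul hTKc).prod hUΩc).image hcj_cont).mul hUKc
  refine ⟨TΩ * T₀ * TK, unipotentRadicalPEquiv n K '' V, (hTΩc.mul hT₀c).mul hTKc,
    hVc.image (unipotentRadicalPEquiv n K).continuous, ?_⟩
  -- the containment
  intro a m u hmu
  obtain ⟨y, ⟨x, ⟨ω, hω, rfl⟩, p, hp, rfl⟩, κ, hκ, hy⟩ := hmu
  -- all factors lie in `B`
  have hωB : ω ∈ (Bor) := hΩP hω
  obtain ⟨q, hq⟩ := hP₀ hp
  have hpB : p ∈ (Bor) := by rw [← hq]; exact posRealDiagonal_mem_standardParabolicGL q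
  have hmuB : ((m : Bor) : GL (Fin n) 𝔸) * ((u : Bor) : GL (Fin n) 𝔸) ∈ (Bor) :=
    Subgroup.mul_mem _ (m : Bor).2 (u : Bor).2
  have hκB : κ ∈ (Bor) := by
    have : κ = (posRealDiagonal n K a * ω * (posRealDiagonal n K a)⁻¹ * p)⁻¹ *
        (((m : Bor) : GL (Fin n) 𝔸) * ((u : Bor) : GL (Fin n) 𝔸)) := by
      rw [← hy, inv_mul_cancel_left]
    rw [this]
    refine Subgroup.mul_mem _ (Subgroup.inv_mem _ (Subgroup.mul_mem _
      (Subgroup.mul_mem _ (Subgroup.mul_mem _ (posRealDiagonal_mem_standardParabolicGL a) hωB)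
        (Subgroup.inv_mem _ (posRealDiagonal_mem_standardParabolicGL a))) hpB)) hmuB
  -- lifts to `B` (opaque variables with their defining equations, to keep unification cheap)
  obtain ⟨ωP, hωP⟩ : ∃ z : ↥(Bor), z = ⟨ω, hωB⟩ := ⟨_, rfl⟩
  obtain ⟨pP, hpP⟩ : ∃ z : ↥(Bor), z = ⟨p, hpB⟩ := ⟨_, rfl⟩
  obtain ⟨κP, hκP⟩ : ∃ z : ↥(Bor), z = ⟨κ, hκB⟩ := ⟨_, rfl⟩
  obtain ⟨D, hD⟩ : ∃ z : ↥(Bor), z = (posRealTorus n K a : Bor) := ⟨_, rfl⟩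
  have hDT : D ∈ (Tor) := by rw [hD]; exact (posRealTorus n K a).2
  have hpT : pP ∈ (Tor) := by
    refine mem_leviP_id_of_apply_eq_zero fun i j hij => ?_
    rw [hpP]
    change (p : Matrix (Fin n) (Fin n) 𝔸) i j = 0
    rw [← hq, coe_posRealDiagonal, Matrix.diagonal_apply_ne _ hij]
  have hωmem : ωP ∈ Ω' := by rw [hωP]; exact hω
  have hpmem : pP ∈ P₀' := by rw [hpP]; exact hp
  have hκmem : κP ∈ K' := by rw [hκP]; exact hκ
  -- Levi–unipotent coordinates of `ω` and `κ`
  obtain ⟨⟨aω, uω⟩, hωe⟩ : ∃ z : ↥(Tor) × ↥(Uni), e.symm ωP = z := ⟨_, rfl⟩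
  obtain ⟨⟨aκ, uκ⟩, hκe⟩ : ∃ z : ↥(Tor) × ↥(Uni), e.symm κP = z := ⟨_, rfl⟩
  have hωe' : (aω : Bor) * (uω : Bor) = ωP := by
    have h := e.apply_symm_apply ωP
    rw [hωe] at h
    exact h
  have hκe' : (aκ : Bor) * (uκ : Bor) = κP := by
    have h := e.apply_symm_apply κP
    rw [hκe] at h
    exact h
  -- memberships of the coordinates
  have haωmem : aω ∈ TΩ := ⟨(aω, uω), ⟨ωP, hωmem, hωe⟩, rfl⟩
  have huωmem : uω ∈ UΩ := ⟨(aω, uω), ⟨ωP, hωmem, hωe⟩, rfl⟩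
  have haκmem : aκ ∈ TK := ⟨(aκ, uκ), ⟨κP, hκmem, hκe⟩, rfl⟩
  have huκmem : uκ ∈ UK := ⟨(aκ, uκ), ⟨κP, hκmem, hκe⟩, rfl⟩
  have hpTmem : (⟨pP, hpT⟩ : ↥(Tor)) ∈ T₀ := hpmem
  -- `D` fixes `uκ` (archimedean triviality of the unipotent part of `κ ∈ B ∩ K`)
  have huκ_fix : D * (uκ : Bor) * D⁻¹ = (uκ : Bor) := by
    have huκ2 : uκ = (e.symm κP).2 := by rw [hκe]
    have h1 : unipotentDiagConj (fun i => posRealIdele K (a i)) (unipotentRadicalPEquiv n K uκ) =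
        unipotentRadicalPEquiv n K uκ := by
      refine unipotentDiagConj_posRealIdele_eq_self a fun i j hij => ?_
      rw [huκ2, hκP]
      exact fst_apply_unipotentPart_eq_zero hκ hκB hij
    have h2 := congrArg (fun v : ↥(adelicUnipotent n K) => (v : GL (Fin n) 𝔸)) h1
    simp only [coe_unipotentDiagConj, coe_unipotentRadicalPEquiv] at h2
    rw [hD]
    exact Subtype.ext h2
  -- commutation relations in the torus, as relations in `B`
  have hR1 : D * (aω : Bor) = (aω : Bor) * D := mul_comm_of_mem_leviP_id hDT aω.2
  have hR2 : D⁻¹ * ((pP : Bor) * (aκ : Bor)) = ((pP : Bor) * (aκ : Bor)) * D⁻¹ :=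
    mul_comm_of_mem_leviP_id (Subgroup.inv_mem _ hDT) (Subgroup.mul_mem _ hpT aκ.2)
  have hR2' : ((pP : Bor) * (aκ : Bor)) * D = D * ((pP : Bor) * (aκ : Bor)) :=
    mul_comm_of_mem_leviP_id (Subgroup.mul_mem _ hpT aκ.2) hDT
  have hR3 : D⁻¹ * (uκ : Bor) = (uκ : Bor) * D⁻¹ := by
    calc D⁻¹ * (uκ : Bor) = D⁻¹ * (D * (uκ : Bor) * D⁻¹) := by rw [huκ_fix]
      _ = (uκ : Bor) * D⁻¹ := by simp only [mul_assoc, inv_mul_cancel_left]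
  -- the new unipotent coordinate `v` and its `D`-conjugate `v'`
  set pT : ↥(Tor) := ⟨pP, hpT⟩ with hpT'
  have hvmem : cj (pT * aκ, uω) * uκ ∈ V :=
    ⟨cj (pT * aκ, uω), ⟨(pT * aκ, uω), ⟨⟨pT, hpTmem, aκ, haκmem, rfl⟩, huωmem⟩, rfl⟩,
      uκ, huκmem, rfl⟩
  have hcoev : ((cj (pT * aκ, uω) * uκ : ↥(Uni)) : Bor) =
      ((pP : Bor) * (aκ : Bor))⁻¹ * (uω : Bor) * ((pP : Bor) * (aκ : Bor)) * (uκ : Bor) := rfl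
  have hv'mem : D * ((cj (pT * aκ, uω) * uκ : ↥(Uni)) : Bor) * D⁻¹ ∈ (Uni) :=
    (inferInstance : (Uni).Normal).conj_mem _ (cj (pT * aκ, uω) * uκ).2 _
  -- the identity `m u = (aω pT aκ) · v'` in `B`: both sides equal `W`
  have hL : D * ωP * D⁻¹ * pP * κP =
      (aω : Bor) * D * (uω : Bor) * ((pP : Bor) * (aκ : Bor)) * (uκ : Bor) * D⁻¹ := by
    rw [← hωe', ← hκe']
    calc D * ((aω : Bor) * (uω : Bor)) * D⁻¹ * pP * ((aκ : Bor) * (uκ : Bor))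
        = D * (aω : Bor) * (uω : Bor) * (D⁻¹ * ((pP : Bor) * (aκ : Bor))) * (uκ : Bor) := by
          simp only [mul_assoc]
      _ = (aω : Bor) * D * (uω : Bor) * (((pP : Bor) * (aκ : Bor)) * D⁻¹) * (uκ : Bor) := by
          rw [hR1, hR2]
      _ = (aω : Bor) * D * (uω : Bor) * ((pP : Bor) * (aκ : Bor)) * (D⁻¹ * (uκ : Bor)) := by
          simp only [mul_assoc]
      _ = (aω : Bor) * D * (uω : Bor) * ((pP : Bor) * (aκ : Bor)) * ((uκ : Bor) * D⁻¹) := by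
          rw [hR3]
      _ = (aω : Bor) * D * (uω : Bor) * ((pP : Bor) * (aκ : Bor)) * (uκ : Bor) * D⁻¹ := by
          simp only [mul_assoc]
  have hR : ((aω * pT * aκ : ↥(Tor)) : Bor) * (D * ((cj (pT * aκ, uω) * uκ : ↥(Uni)) : Bor) * D⁻¹) =
      (aω : Bor) * D * (uω : Bor) * ((pP : Bor) * (aκ : Bor)) * (uκ : Bor) * D⁻¹ := by
    rw [hcoev]
    calc ((aω * pT * aκ : ↥(Tor)) : Bor) *
          (D * (((pP : Bor) * (aκ : Bor))⁻¹ * (uω : Bor) * ((pP : Bor) * (aκ : Bor)) * (uκ : Bor)) * D⁻¹)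
        = (aω : Bor) * (((pP : Bor) * (aκ : Bor)) * D) *
            ((((pP : Bor) * (aκ : Bor))⁻¹ * (uω : Bor) * ((pP : Bor) * (aκ : Bor)) * (uκ : Bor)) *
              D⁻¹) := by
          change (aω : Bor) * (pP : Bor) * (aκ : Bor) * _ = _
          simp only [mul_assoc]
      _ = (aω : Bor) * (D * ((pP : Bor) * (aκ : Bor))) *
            ((((pP : Bor) * (aκ : Bor))⁻¹ * (uω : Bor) * ((pP : Bor) * (aκ : Bor)) * (uκ : Bor)) *
              D⁻¹) := by
          rw [hR2']
      _ = (aω : Bor) * D * (uω : Bor) * ((pP : Bor) * (aκ : Bor)) * (uκ : Bor) * D⁻¹ := by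
          simp only [mul_assoc, mul_inv_cancel_left]
  have hprod : (m : Bor) * (u : Bor) =
      ((aω * pT * aκ : ↥(Tor)) : Bor) * (D * ((cj (pT * aκ, uω) * uκ : ↥(Uni)) : Bor) * D⁻¹) := by
    have hlhs : (m : Bor) * (u : Bor) = D * ωP * D⁻¹ * pP * κP := by
      rw [hD, hωP, hpP, hκP]
      refine Subtype.ext ?_
      change ((m : Bor) : GL (Fin n) 𝔸) * ((u : Bor) : GL (Fin n) 𝔸) =
        posRealDiagonal n K a * ω * (posRealDiagonal n K a)⁻¹ * p * κ
      exact hy.symm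
    rw [hlhs, hL, hR]
  have hcoord : (m, u) = (aω * pT * aκ, ⟨_, hv'mem⟩) := by
    apply e.injective
    exact hprod
  obtain ⟨hm, hu⟩ := Prod.mk_inj.1 hcoord
  subst hm
  subst hu
  refine ⟨⟨aω * pT, ⟨aω, haωmem, pT, hpTmem, rfl⟩, aκ, haκmem, rfl⟩, ?_⟩
  refine ⟨unipotentRadicalPEquiv n K (cj (pT * aκ, uω) * uκ), ⟨_, hvmem, rfl⟩, ?_⟩
  rw [← unipotentRadicalPEquiv_conj n K a]
  congr 1
  refine Subtype.ext ?_
  change (posRealTorus n K a : Bor) * _ * ((posRealTorus n K a : Bor))⁻¹ = D * _ * D⁻¹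
  rw [hD]

end Coordinates

end Literature.NumberTheory.Automorphic
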